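import Mathlib
import Summits.NavierStokesRegularity.NavierStokesRegularity.Theorems.EulerZoomLiouvillePowerGaugeEulerLiouvilleSelfSimilarTopBadNodeFloorDynamics
import HarnessLib.Audit

/-!
# Rung C1 of the crux `EulerZoomLiouville.PowerGaugeEulerLiouville`: the THRESHOLD DICHOTOMY for the transversal coordinates
# (inventory item (vi-a) of the no-exit lemma — "GAP A" of the addendum)

Route №10 `EulerZoomLiouville` (NavierStokesRegularity), crux E = stmt-NavierStokesRegularity-19832,
tenure rung C1 (exactly self-similar members), registered residue `stub_selfSimilarExtremal`.
Twentieth file of the NODAL-CONTINUUM line (lineage ns-typeII-p1, gen 7).  Real-variable engine of the CASE I / CASE II split in the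
no-exit lemma (evidence NO-EXIT-LEMMA + ADDENDUM on the crux item): for `p, m ≥ 0` (backward-contracting / expanding parts of
`|ξ|²`) with `p' ≤ −μp + c(p+m) + Ψ`, `m' ≥ μm − c(p+m) − Ψ` on `[0, t₁]` (`c(1+K) ≤ μ/4`, `K ≥ 1`, floor `Ψ ≥ 0`) and a threshold
`Θ ≥ max(8(1+K)Ψ/μ, p(0)+m(0))`, `Θ > 0`:

* `cone_persists_of_ineq` — if `Kp ≤ m` and `2Θ ≤ m` at time `t`, then `Kp ≤ m` (and `m ≥ 2Θ`) up to `t₁` (joint barrier: inside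
  the cone `m' ≥ (μ/2)m − Ψ > 0`, so `|ξ|² ≥ m ≥ 2Θ` keeps `(m − Kp)' ≥ (3μ/4)Θ − (1+K)Ψ > 0`);
* (sequel, to do) `cone_of_threshold` — if `p + m ≥ 2(1+K)Θ` at some `t ≤ t₁`, then `Kp(t₁) ≤ m(t₁)` (last time below `Θ`,
  monotonicity of `m − Kp` above the threshold, a decay barrier for `p` outside the cone, then `cone_persists_of_ineq`);
  contrapositive (CASE II-nocone): if `Kp(t₁) > m(t₁)` then `p + m < 2(1+K)Θ` throughout `[0, t₁]`.

WHAT THIS IS NOT: not NS, not E — elementary real analysis. [cite: KatokHasselblatt1995, §6.2 (cone criterion)]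
-/

noncomputable section

-- flat `Theorems/<Route><Decl>…` files of one crux share the namespace of the crux (tree convention)
set_option linter.dupNamespace false

open Set Filter Topology Metric Function

namespace Summit.NavierStokesRegularity.NavierStokesRegularity.Theorems.PowerGaugeEulerLiouville.NodalContinuum

/-- **Cone persistence.**  If `Kp ≤ m` and `2Θ ≤ m` at `t ∈ [0, t₁]`, then `Kp ≤ m` on `[t, t₁]`. [cite: KatokHasselblatt1995, §6.2 (cone criterion, with forcing)] -/
theorem cone_persists_of_ineq {p m pd md : ℝ → ℝ} {K μ c Ψ Θ t t₁ : ℝ} (hK1 : 1 ≤ K) (hμ : 0 < μ) (hc0 : 0 ≤ c)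
    (hcK : c * (1 + K) ≤ μ / 4) (hΨ : 0 ≤ Ψ) (hΘ : 8 * (1 + K) * Ψ / μ ≤ Θ) (hΘpos : 0 < Θ)
    (hp' : ∀ s ∈ Icc 0 t₁, HasDerivAt p (pd s) s) (hm' : ∀ s ∈ Icc 0 t₁, HasDerivAt m (md s) s)
    (hpnn : ∀ s ∈ Icc 0 t₁, 0 ≤ p s)
    (hpd : ∀ s ∈ Icc 0 t₁, pd s ≤ -μ * p s + c * (p s + m s) + Ψ)
    (hmd : ∀ s ∈ Icc 0 t₁, μ * m s - c * (p s + m s) - Ψ ≤ md s)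
    (ht : t ∈ Icc 0 t₁) (hcone : K * p t ≤ m t) (hbig : 2 * Θ ≤ m t) :
    ∀ u ∈ Icc t t₁, K * p u ≤ m u ∧ 2 * Θ ≤ m u := by
  have hKpos : 0 < K := by linarith
  have hsub : Icc t t₁ ⊆ Icc 0 t₁ := Icc_subset_Icc ht.1 le_rfl
  have hΨΘ : (1 + K) * Ψ ≤ μ * Θ / 8 := by
    have := (div_le_iff₀ hμ).1 hΘ
    linarith
  -- the derivative lower bounds
  have hDd : ∀ s ∈ Icc 0 t₁, K * p s ≤ m s → 2 * Θ ≤ m s →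
      3 * μ / 4 * Θ ≤ md s - K * pd s := by
    intro s hs hc2 hm2
    have h1 := hpd s hs
    have h2 := hmd s hs
    have hps := hpnn s hs
    have h1K := mul_le_mul_of_nonneg_left h1 hKpos.le
    have hm0 : 0 ≤ m s := by nlinarith [hc2, hps, hKpos]
    have h3 : c * (1 + K) * (p s + m s) ≤ μ / 4 * (p s + m s) :=
      mul_le_mul_of_nonneg_right hcK (by linarith)
    have hpK : p s ≤ K * p s := le_mul_of_one_le_left hps hK1
    have hpm : p s ≤ m s := hpK.trans hc2
    have h4 : μ / 4 * (p s + m s) ≤ μ / 2 * m s := by nlinarith [hpm, hμ]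
    have h5 : μ * Θ ≤ μ / 2 * m s := by nlinarith [hm2, hμ]
    have h6 : 0 ≤ μ * (K * p s) := by positivity
    have e1 : c * (1 + K) * (p s + m s) = c * (p s + m s) + K * (c * (p s + m s)) := by ring
    have h7 : 0 ≤ μ * Θ := by positivity
    linarith [h1K, h2, h3, h4, h5, h6, h7, hΨΘ, e1]
  have hmdd : ∀ s ∈ Icc 0 t₁, K * p s ≤ m s → μ / 2 * m s - Ψ ≤ md s := by
    intro s hs hc2
    have h2 := hmd s hs
    have hps := hpnn s hs
    have hm0 : 0 ≤ m s := by nlinarith [hc2, hps, hKpos]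
    have h3 : c * (p s + m s) ≤ μ / 4 * (p s + m s) := by
      have hc1 : c ≤ c * (1 + K) := by nlinarith [hc0, hK1]
      exact mul_le_mul_of_nonneg_right (hc1.trans hcK) (by linarith)
    have hpK : p s ≤ K * p s := le_mul_of_one_le_left hps hK1
    have hpm : p s ≤ m s := hpK.trans hc2
    have h4 : μ / 4 * (p s + m s) ≤ μ / 2 * m s := by nlinarith [hpm, hμ]
    linarith [h2, h3, h4]
  -- continuity
  have hDc : ContinuousOn (fun s => m s - K * p s) (Icc t t₁) := fun s hs =>
    ((hm' s (hsub hs)).sub ((hp' s (hsub hs)).const_mul K)).continuousAt.continuousWithinAt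
  have hmc : ContinuousOn m (Icc t t₁) := fun s hs => (hm' s (hsub hs)).continuousAt.continuousWithinAt
  -- the bad set and its infimum
  by_contra hbad
  push Not at hbad
  obtain ⟨u₀, hu₀, hu₀bad⟩ := hbad
  set B : Set ℝ := {u | u ∈ Icc t t₁ ∧ (m u < K * p u ∨ m u < 2 * Θ)} with hB
  have hBne : B.Nonempty := by
    refine ⟨u₀, hu₀, ?_⟩
    by_cases h1 : K * p u₀ ≤ m u₀
    · exact Or.inr (hu₀bad h1)
    · exact Or.inl (not_le.1 h1)
  have hBbdd : BddBelow B := ⟨t, fun u hu => hu.1.1⟩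
  set u₁ := sInf B with hu₁
  have hu₁t : t ≤ u₁ := le_csInf hBne fun u hu => hu.1.1
  have hu₁t₁ : u₁ ≤ t₁ := (csInf_le hBbdd ⟨hu₀, by
    by_cases h1 : K * p u₀ ≤ m u₀
    · exact Or.inr (hu₀bad h1)
    · exact Or.inl (not_le.1 h1)⟩).trans hu₀.2
  have hu₁mem : u₁ ∈ Icc t t₁ := ⟨hu₁t, hu₁t₁⟩
  -- before `u₁` everything is good
  have hgood : ∀ u ∈ Ico t u₁, K * p u ≤ m u ∧ 2 * Θ ≤ m u := by
    intro u hu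
    by_contra hneg
    have huB : u ∈ B := by
      refine ⟨⟨hu.1, hu.2.le.trans hu₁t₁⟩, ?_⟩
      by_cases h1 : K * p u ≤ m u
      · right; by_contra h2; exact hneg ⟨h1, not_lt.1 h2⟩
      · exact Or.inl (not_le.1 h1)
    exact absurd (csInf_le hBbdd huB) (not_le.2 hu.2)
  -- by continuity the good inequalities hold at `u₁` as well
  have hgood₁ : K * p u₁ ≤ m u₁ ∧ 2 * Θ ≤ m u₁ := by
    rcases hu₁t.eq_or_lt with h0 | h0
    · rw [← h0]; exact ⟨hcone, hbig⟩
    · -- limits from the left along `Ico t u₁`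
      haveI : (𝓝[Ico t u₁] u₁).NeBot :=
        mem_closure_iff_nhdsWithin_neBot.1 (by rw [closure_Ico h0.ne]; exact ⟨h0.le, le_rfl⟩)
      have hsubI : Ico t u₁ ⊆ Icc t t₁ := fun u hu => ⟨hu.1, hu.2.le.trans hu₁t₁⟩
      have hD1 : Tendsto (fun s => m s - K * p s) (𝓝[Ico t u₁] u₁) (𝓝 (m u₁ - K * p u₁)) :=
        ((hDc u₁ hu₁mem).mono hsubI).tendsto
      have hm1 : Tendsto m (𝓝[Ico t u₁] u₁) (𝓝 (m u₁)) := ((hmc u₁ hu₁mem).mono hsubI).tendsto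
      have hev : ∀ᶠ s in 𝓝[Ico t u₁] u₁, 0 ≤ m s - K * p s ∧ 2 * Θ ≤ m s :=
        eventually_nhdsWithin_of_forall fun s hs => ⟨by linarith [(hgood s hs).1], (hgood s hs).2⟩
      constructor
      · have := ge_of_tendsto hD1 (hev.mono fun s hs => hs.1); linarith
      · exact ge_of_tendsto hm1 (hev.mono fun s hs => hs.2)
  -- derivatives at `u₁` are positive; so just after `u₁` things are still good — contradiction with `u₁ = inf B`
  have hu₁0 : u₁ ∈ Icc 0 t₁ := hsub hu₁mem
  have hD' : 3 * μ / 4 * Θ ≤ md u₁ - K * pd u₁ := hDd u₁ hu₁0 hgood₁.1 hgood₁.2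
  have hm'1 : μ / 2 * m u₁ - Ψ ≤ md u₁ := hmdd u₁ hu₁0 hgood₁.1
  have hmdpos : 0 < md u₁ := by
    have : Ψ ≤ μ * Θ / 8 := by nlinarith [hΨΘ, hK1, hΨ]
    nlinarith [hm'1, hgood₁.2, hμ, hΘpos]
  have hDdpos : 0 < md u₁ - K * pd u₁ := by nlinarith [hD', hμ, hΘpos]
  have hderD : HasDerivAt (fun s => m s - K * p s) (md u₁ - K * pd u₁) u₁ :=
    (hm' u₁ hu₁0).sub ((hp' u₁ hu₁0).const_mul K)
  have hderm : HasDerivAt m (md u₁) u₁ := hm' u₁ hu₁0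
  -- slopes are positive just to the right of `u₁`
  have hslopeD : ∀ᶠ u in 𝓝[>] u₁, 0 < slope (fun s => m s - K * p s) u₁ u := by
    have h := (hasDerivAt_iff_tendsto_slope.1 hderD).eventually (lt_mem_nhds hDdpos)
    exact nhdsWithin_mono _ (fun z hz => ne_of_gt hz) h
  have hslopem : ∀ᶠ u in 𝓝[>] u₁, 0 < slope m u₁ u := by
    have h := (hasDerivAt_iff_tendsto_slope.1 hderm).eventually (lt_mem_nhds hmdpos)
    exact nhdsWithin_mono _ (fun z hz => ne_of_gt hz) h
  obtain ⟨η, hη, hηsub⟩ := mem_nhdsGT_iff_exists_Ioo_subset.1 (hslopeD.and hslopem)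
  -- all points of `[u₁, η) ∩ [t, t₁]` are good
  have hgood2 : ∀ u ∈ Ico u₁ η, u ∈ Icc t t₁ → K * p u ≤ m u ∧ 2 * Θ ≤ m u := by
    intro u hu hut
    rcases hu.1.eq_or_lt with h0 | h0
    · rw [← h0]; exact hgood₁
    · have hz := hηsub ⟨h0, hu.2⟩
      simp only [mem_setOf_eq, slope_def_field] at hz
      have hpos : 0 < u - u₁ := by linarith
      have h1 := (div_pos_iff_of_pos_right hpos).1 hz.1
      have h2 := (div_pos_iff_of_pos_right hpos).1 hz.2
      constructor <;> linarith [hgood₁.1, hgood₁.2]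
  -- hence every element of `B` is `≥ η`, contradicting `u₁ = inf B < η`
  have hBge : ∀ u ∈ B, η ≤ u := by
    intro u hu
    by_contra hlt
    push Not at hlt
    have hu1 : u₁ ≤ u := csInf_le hBbdd hu
    have hg := hgood2 u ⟨hu1, hlt⟩ hu.1
    rcases hu.2 with hb | hb <;> linarith [hg.1, hg.2]
  have : η ≤ u₁ := le_csInf hBne hBge
  exact absurd this (not_le.2 hη)

end Summit.NavierStokesRegularity.NavierStokesRegularity.Theorems.PowerGaugeEulerLiouville.NodalContinuum
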